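/-
Copyright (c) 2026 the pub-hodgecm-mathlib formalisation cell (harness21).  Prover seat hodgecm-mathlib-F0P2-p06 (g13): road «S3-ram» (LEAD F0P3a-plan (g12); architect
A-p16 (g31); owner F0P3a-p06 (g15)), organ A′ (ii) (B4) G3⁵ «THE RESIDUAL DATUM OF A FIXED VERTEX»; 2026-09-02.
-/
import Literature.NumberTheory.Automorphic.UnitaryLatticeTreeRootStarPredicateCountRamified   -- ★ p847467 (this seat, g13): G3⁗ predicate ν-bridge; brings ★ G3′ G3″ G3‴ G3⁺
import Literature.NumberTheory.Automorphic.UnitaryLatticeTreeRankOneVertexShapeRamified      -- ★ p847456 (F0P2-p01 (g15)): FILE K odd-depth symmetry; brings ★ FILE H `map_toLin'_latt_le_scaleLattice_iff`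
import HarnessLib

/-!
# The lattice graph of a hermitian space — THE RESIDUAL DATUM OF A FIXED VERTEX at a tamely ramified place: from the lattice tokens of a fixed self-dual vertex `u·L₀`
# (level `ϖ^d`, square level `ϖ^{2d+1}`, cube level `ϖ^{3d+1}`, odd `d`) to the `J̄₀`-symmetric nilpotent residual matrix `Ȳ = ϖ^{−d}(u⁻¹γu − 1) mod ϖ` and its rank
# (Bruhat–Tits 1972 §10; Tits 1979 §3.5; Kottwitz 1986 §3)

Topic `NumberTheory/Automorphic`; namespace `Literature.NumberTheory.Automorphic.UnitaryLatticeTree`.  THEOREMS ONLY (no definition, no instance, no notation, no named fact,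
no `sorry`); kernel lane `--supports stmt-HodgeConjecture-24833`.  Cell `pub/hodgecm-mathlib` (D-0151), crux H413; road «S3-ram» (Literature seeding, count-neutral), organ
A′ (ii) (B4) of the P-1-ram skeleton (architect A-p16 (g31)), part **G3⁵** — the last glue between the tree-induction engine's LATTICE tokens (★ junction head ∕ ★ J0
`Rogawski1990/DepthZeroKappaTransferTypeOneRamifiedDiagonalModel`: `LEV c M := (γ − 1)·M ⊆ c·M`, `LEV₂`, and the nilpotency token `LEV₃` of ★ FILE J) and the RESIDUAL
hypotheses of the counting organs ★ G3″ (p847343) ∕ ★ G3‴ (p847443) ∕ ★ G3⁗ (p847467): «`Ȳ` is `J̄₀`-symmetric, `Ȳ³ = 0`, `Ȳ² ≠ 0` (rank two) or `Ȳ² = 0 ≠ Ȳ` (rank one)»,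
`Ȳ := Y₀ mod ϖ` for an `𝒪`-valued `Y₀` with `Y₀ = (ϖ^d)⁻¹·(u⁻¹γu − 1)`.

* §1 RESIDUE-MATRIX DICTIONARY (any matrix `M`, `Y₀ = (ϖ^d)⁻¹·M` integral): **`map_residue_pow_eq_zero_iff`** (`Ȳ^k = 0 ↔ |(M^k)_{ij}| ≤ |ϖ|^{dk+1}` for all `i j`),
  `map_residue_eq_zero_iff` (`k = 1`), `exists_integerMatrix_of_forall_v_le` (such a `Y₀` exists iff `|M_{ij}| ≤ |ϖ|^d`).
* §2 AT A UNITARY ELEMENT `γ′` (`M = γ′ − 1`): **`antidiagonal_inv_mul_transpose_map_residue_mul_eq_of_odd`** — for ODD `d` the residual matrix is `J̄₀`-SYMMETRIC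
  (`J̄₀⁻¹ Ȳᵀ J̄₀ = Ȳ`; ★ FILE K `v_coe_sub_one_apply_sub_rev_le_of_odd` read residually); the LATTICE TOKENS at `v = u·L₀` in the frame `u`:
  **`map_pow_le_scaleLattice_latticeGraphIso_root_iff`** (`(γ − 1)^k·v ⊆ c·v ↔ |((u⁻¹γu − 1)^k)_{ij}| ≤ |c|`, ★ FILE H `map_toLin'_latt_le_scaleLattice_iff` + `Units.conj_pow'`).
* §3 THE RESIDUAL DATUM FROM THE TOKENS: **`exists_residualDatum_of_tokens`** — at `v = u·L₀` with `LEV (ϖ^d) v`, odd `d`: an integral `Y₀` with `Y₀ = (ϖ^d)⁻¹(u⁻¹γu − 1)`,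
  `Ȳ` `J̄₀`-symmetric, and `Ȳ³ = 0 ↔ LEV₃ (ϖ^{3d+1}) v`, `Ȳ² = 0 ↔ LEV₂ (ϖ^{2d+1}) v`, `Ȳ = 0 ↔ LEV (ϖ^{d+1}) v`; and the JUNCTION-READY line counts
  **`two_mul_ncard_neighborSet_quadraticChar_eq_of_tokens`** (`hO`: rank two ⇒ `2·#{neighbours of v with line class σ} = q − 1`), **`ncard_neighborSet_null_eq_two_of_tokens`**
  (`2` null lines), **`ncard_neighborSet_null_eq_one_of_tokens`** (rank one: `1` null line), `exists_conj_cornerSymmetric_of_tokens` (rank one: `ḡȲḡ⁻¹ = N(c)`, `c ≠ 0`).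

HONEST LABEL: HC_CM is proved only modulo the 2 remaining named inputs (hLiu418 24832, h413 24833) until rung 0 closes; nothing printed is asserted here (residual bookkeeping
over ★ results); «S3-ram» has no books consequence.

## References
* [BruhatTits1972] F. Bruhat, J. Tits, *Groupes réductifs sur un corps local I*, Publ. Math. IHÉS 41 (1972), §10 (vertex stabilisers, their congruence filtration and reduction).
* [Tits1979] J. Tits, *Reductive groups over local fields*, PSPM 33.1 (1979), §3.5 (reduction mod `𝔭` of the Moy–Prasad-type filtration).
* [Kottwitz1986] R. E. Kottwitz, *Base change for unit elements of Hecke algebras*, Compositio Math. 60 (1986), §3 (the residual datum of a fixed lattice).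
* [Serre1980Trees] J.-P. Serre, *Trees* (1980), Ch. II §1.1 (lattices and frames).
-/

set_option autoImplicit false

noncomputable section

open scoped Valued WithZero Matrix MatrixGroups

namespace Literature.NumberTheory.Automorphic.UnitaryLatticeTree

open Literature.NumberTheory.Automorphic Literature.NumberTheory.Automorphic.HermitianLattice
open Literature.NumberTheory.Automorphic.CartanUnique Literature.NumberTheory.Automorphic.UnitaryGroup
open Literature.GroupTheory.SpecificGroups

variable {K : Type*} [Field K] [Valued K ℤᵐ⁰] {σ : K →+* K} {ϖ : K}

/-! ## §1 The residue-matrix dictionary: powers of `Ȳ` vanish iff the corresponding power token holds -/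

/-- The integral leading term as a scalar multiple: `M = ϖ^d • Y₀` over `K`. [cite: Kottwitz1986, §3] -/
theorem eq_smul_map_subtype_of_integerMatrix (hϖ0 : ϖ ≠ 0) {d : ℕ} (M : Matrix (Fin 3) (Fin 3) K) (Y₀ : Matrix (Fin 3) (Fin 3) 𝒪[K])
    (hY₀ : ∀ i j, ((Y₀ i j : 𝒪[K]) : K) = (ϖ ^ d)⁻¹ * M i j) :
    M = (ϖ ^ d) • Y₀.map ((Valued.integer K).subtype) := by
  ext i j
  rw [Matrix.smul_apply, Matrix.map_apply, Subring.coe_subtype, hY₀, smul_eq_mul, mul_inv_cancel_left₀ (pow_ne_zero _ hϖ0)]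

/-- **`Ȳ^k = 0 ↔ |(M^k)_{ij}| ≤ |ϖ|^{dk+1}` for all `i, j`** (`Y₀ = (ϖ^d)⁻¹·M` integral, `Ȳ = Y₀ mod ϖ`; `k ≥ 1`): `M^k = ϖ^{dk}·Y₀^k` and an integer has residue `0` iff its valuation
is `< 1 = |ϖ|⁰`, i.e. `≤ |ϖ|`. [cite: Kottwitz1986, §3] [cite: Tits1979, §3.5] -/
theorem map_residue_pow_eq_zero_iff (hϖ : Valued.v ϖ = WithZero.exp (-1 : ℤ)) {d : ℕ} (M : Matrix (Fin 3) (Fin 3) K) (Y₀ : Matrix (Fin 3) (Fin 3) 𝒪[K])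
    (hY₀ : ∀ i j, ((Y₀ i j : 𝒪[K]) : K) = (ϖ ^ d)⁻¹ * M i j) (k : ℕ) :
    (Y₀.map (IsLocalRing.residue 𝒪[K])) ^ k = 0 ↔ ∀ i j, Valued.v ((M ^ k) i j) ≤ Valued.v ϖ ^ (d * k + 1) := by
  have hϖ0 : ϖ ≠ 0 := uniformizer_ne_zero hϖ
  have hvϖ0 : Valued.v ϖ ≠ 0 := (Valuation.ne_zero_iff _).2 hϖ0
  have hlt1 : ∀ z : K, Valued.v z < 1 ↔ Valued.v z ≤ Valued.v ϖ := fun z => by rw [hϖ]; exact v_lt_one_iff z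
  have hMk : ∀ i j, (M ^ k) i j = (ϖ ^ d) ^ k * (((Y₀ ^ k) i j : 𝒪[K]) : K) := by
    intro i j
    rw [eq_smul_map_subtype_of_integerMatrix hϖ0 M Y₀ hY₀, smul_pow, ← Matrix.map_pow, Matrix.smul_apply, Matrix.map_apply, Subring.coe_subtype, smul_eq_mul]
  rw [← Matrix.map_pow]
  constructor
  · intro h i j
    have hij : Valued.v (((Y₀ ^ k) i j : 𝒪[K]) : K) ≤ Valued.v ϖ := by
      have := congrFun (congrFun h i) j
      rw [Matrix.map_apply, Matrix.zero_apply, residue_eq_zero_iff_v_lt_one, hlt1] at this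
      exact this
    rw [hMk, map_mul, map_pow, map_pow, ← pow_mul, pow_succ]
    exact mul_le_mul' le_rfl hij
  · intro h
    ext i j
    rw [Matrix.map_apply, Matrix.zero_apply, residue_eq_zero_iff_v_lt_one, hlt1]
    have hij := h i j
    rw [hMk, map_mul, map_pow, map_pow, ← pow_mul, pow_succ] at hij
    have h' := mul_le_mul' (le_refl ((Valued.v ϖ ^ (d * k))⁻¹)) hij
    rwa [← mul_assoc, ← mul_assoc, inv_mul_cancel₀ (pow_ne_zero _ hvϖ0), one_mul, one_mul] at h'

/-- **`Ȳ = 0 ↔ |M_{ij}| ≤ |ϖ|^{d+1}`** (the case `k = 1`: the depth of `M` EXCEEDS `d` iff the depth-`d` leading term vanishes). [cite: Kottwitz1986, §3] -/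
theorem map_residue_eq_zero_iff (hϖ : Valued.v ϖ = WithZero.exp (-1 : ℤ)) {d : ℕ} (M : Matrix (Fin 3) (Fin 3) K) (Y₀ : Matrix (Fin 3) (Fin 3) 𝒪[K])
    (hY₀ : ∀ i j, ((Y₀ i j : 𝒪[K]) : K) = (ϖ ^ d)⁻¹ * M i j) :
    Y₀.map (IsLocalRing.residue 𝒪[K]) = 0 ↔ ∀ i j, Valued.v (M i j) ≤ Valued.v ϖ ^ (d + 1) := by
  have h := map_residue_pow_eq_zero_iff hϖ M Y₀ hY₀ 1
  rwa [pow_one, pow_one, mul_one] at h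

/-- **EXISTENCE OF THE INTEGRAL LEADING TERM**: `|M_{ij}| ≤ |ϖ|^d` for all `i, j` iff there is an `𝒪`-valued `Y₀` with `Y₀ = (ϖ^d)⁻¹·M` entrywise. [cite: Kottwitz1986, §3] -/
theorem exists_integerMatrix_iff_forall_v_le (hϖ : Valued.v ϖ = WithZero.exp (-1 : ℤ)) {d : ℕ} (M : Matrix (Fin 3) (Fin 3) K) :
    (∃ Y₀ : Matrix (Fin 3) (Fin 3) 𝒪[K], ∀ i j, ((Y₀ i j : 𝒪[K]) : K) = (ϖ ^ d)⁻¹ * M i j) ↔ ∀ i j, Valued.v (M i j) ≤ Valued.v ϖ ^ d := by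
  have hϖ0 : ϖ ≠ 0 := uniformizer_ne_zero hϖ
  have hvϖ0 : Valued.v ϖ ≠ 0 := (Valuation.ne_zero_iff _).2 hϖ0
  have hvd0 : Valued.v ϖ ^ d ≠ 0 := pow_ne_zero _ hvϖ0
  constructor
  · rintro ⟨Y₀, hY₀⟩ i j
    have h1 : Valued.v ((ϖ ^ d)⁻¹ * M i j) ≤ 1 := by rw [← hY₀]; exact (Y₀ i j).2
    rw [map_mul, map_inv₀, map_pow] at h1
    have h' := mul_le_mul' (le_refl (Valued.v ϖ ^ d)) h1
    rwa [← mul_assoc, mul_inv_cancel₀ hvd0, one_mul, mul_one] at h'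
  · intro h
    have hint : ∀ i j, (ϖ ^ d)⁻¹ * M i j ∈ 𝒪[K] := fun i j => by
      refine (Valuation.mem_integer_iff _ _).2 ?_
      rw [map_mul, map_inv₀, map_pow]
      have h' := mul_le_mul' (le_refl ((Valued.v ϖ ^ d)⁻¹)) (h i j)
      rwa [inv_mul_cancel₀ hvd0] at h'
    exact ⟨fun i j => ⟨(ϖ ^ d)⁻¹ * M i j, hint i j⟩, fun _ _ => rfl⟩

/-! ## §2 At a unitary element: `J̄₀`-symmetry at odd depth; the lattice tokens in a frame -/

omit [Valued K ℤᵐ⁰] in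
/-- `J̄₀² = 1` for the antidiagonal form (any field), hence `J̄₀⁻¹ = J̄₀`. [cite: BruhatTits1972, §10] -/
theorem antidiagonal_three_over_mul_self {F : Type*} [Field F] :
    (StdForm.antidiagonal 3).over F * (StdForm.antidiagonal 3).over F = 1 := by
  rw [antidiagonal_three_over_eq]
  ext i j; fin_cases i <;> fin_cases j <;> simp [Matrix.mul_apply, Fin.sum_univ_three]

omit [Valued K ℤᵐ⁰] in
/-- `(J̄₀ Xᵀ J̄₀)_{ij} = X_{rev j, rev i}` for the antidiagonal form (any field, any `X`). [cite: BruhatTits1972, §10] -/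
theorem antidiagonal_mul_transpose_mul_antidiagonal_apply {F : Type*} [Field F] (X : Matrix (Fin 3) (Fin 3) F) (i j : Fin 3) :
    ((StdForm.antidiagonal 3).over F * Xᵀ * (StdForm.antidiagonal 3).over F) i j = X j.rev i.rev := by
  rw [antidiagonal_three_over_eq]
  fin_cases i <;> fin_cases j <;> simp [Matrix.mul_apply, Fin.sum_univ_three, Matrix.vecMul, dotProduct]

/-- **ODD DEPTH ⇒ THE RESIDUAL MATRIX IS `J̄₀`-SYMMETRIC**: for `γ′ ∈ U(σ, J₀)` with `|(γ′ − 1)_{ij}| ≤ |ϖ|^d`, `d` odd, and `Y₀ = (ϖ^d)⁻¹(γ′ − 1)` integral, `Ȳ = Y₀ mod ϖ` satisfies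
`J̄₀⁻¹ Ȳᵀ J̄₀ = Ȳ` (the hypothesis `hYs` of ★ G3″∕G3‴; ★ FILE K `v_coe_sub_one_apply_sub_rev_le_of_odd`: `Y_{ij} ≡ Y_{rev j, rev i} (mod ϖ^{d+1})`, and `(J̄₀ȲᵀJ̄₀)_{ij} =
Ȳ_{rev j, rev i}`). [cite: Tits1979, §3.5] [cite: Kottwitz1986, §3] -/
theorem antidiagonal_inv_mul_transpose_map_residue_mul_eq_of_odd (hvσ : ∀ z, Valued.v (σ z) = Valued.v z) (hσϖ : σ ϖ = -ϖ)
    (hϖ : Valued.v ϖ = WithZero.exp (-1 : ℤ)) (hres : ∀ x : K, Valued.v x ≤ 1 → Valued.v (σ x - x) < 1)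
    (γ : unitaryGroupOfForm σ ((StdForm.antidiagonal 3).over K)) {d : ℕ} (hd : Odd d)
    (hY : ∀ i j, Valued.v ((((γ : GL (Fin 3) K) : Matrix (Fin 3) (Fin 3) K) - 1) i j) ≤ Valued.v ϖ ^ d)
    (Y₀ : Matrix (Fin 3) (Fin 3) 𝒪[K]) (hY₀ : ∀ i j, ((Y₀ i j : 𝒪[K]) : K) = (ϖ ^ d)⁻¹ * ((((γ : GL (Fin 3) K) : Matrix (Fin 3) (Fin 3) K) - 1) i j)) :
    ((StdForm.antidiagonal 3).over 𝓀[K])⁻¹ * ((Y₀.map (IsLocalRing.residue 𝒪[K])).map (RingHom.id 𝓀[K]))ᵀ * (StdForm.antidiagonal 3).over 𝓀[K] =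
      Y₀.map (IsLocalRing.residue 𝒪[K]) := by
  have hϖ0 : ϖ ≠ 0 := uniformizer_ne_zero hϖ
  have hvϖ0 : Valued.v ϖ ≠ 0 := (Valuation.ne_zero_iff _).2 hϖ0
  have hlt1 : ∀ z : K, Valued.v z < 1 ↔ Valued.v z ≤ Valued.v ϖ := fun z => by rw [hϖ]; exact v_lt_one_iff z
  -- the residues of `Y₀` are `rev`-symmetric
  have hsym : ∀ i j, IsLocalRing.residue 𝒪[K] (Y₀ i j) = IsLocalRing.residue 𝒪[K] (Y₀ j.rev i.rev) := by
    intro i j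
    apply residue_eq_of_v_sub_lt_one
    rw [hY₀, hY₀, ← mul_sub, hlt1, map_mul, map_inv₀, map_pow]
    have h := v_coe_sub_one_apply_sub_rev_le_of_odd hvσ hσϖ hϖ hres γ hd hY i j
    have h' := mul_le_mul' (le_refl ((Valued.v ϖ ^ d)⁻¹)) h
    rwa [pow_succ, ← mul_assoc, inv_mul_cancel₀ (pow_ne_zero _ hvϖ0), one_mul] at h'
  have hinv : ((StdForm.antidiagonal 3).over 𝓀[K])⁻¹ = (StdForm.antidiagonal 3).over 𝓀[K] :=
    Matrix.inv_eq_left_inv antidiagonal_three_over_mul_self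
  have hid : (Y₀.map (IsLocalRing.residue 𝒪[K])).map (RingHom.id 𝓀[K]) = Y₀.map (IsLocalRing.residue 𝒪[K]) := by
    ext i j; rfl
  rw [hinv, hid]
  ext i j
  rw [antidiagonal_mul_transpose_mul_antidiagonal_apply, Matrix.map_apply, Matrix.map_apply]
  exact (hsym i j).symm

omit [Valued K ℤᵐ⁰] in
/-- **CONJUGATION INTO THE FRAME**: `u⁻¹ (γ − 1) u = u⁻¹γu − 1` as matrices. [cite: Serre1980Trees, II.1.1] -/
theorem coe_inv_mul_sub_one_mul_coe_eq {N : ℕ} {H : Matrix (Fin N) (Fin N) K} (γ u : unitaryGroupOfForm σ H) :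
    (((u : GL (Fin N) K)⁻¹ : GL (Fin N) K) : Matrix (Fin N) (Fin N) K) * ((((γ : GL (Fin N) K) : Matrix (Fin N) (Fin N) K) - 1)) *
        ((u : GL (Fin N) K) : Matrix (Fin N) (Fin N) K) =
      (((u⁻¹ * γ * u : unitaryGroupOfForm σ H) : GL (Fin N) K) : Matrix (Fin N) (Fin N) K) - 1 := by
  rw [Matrix.mul_sub, Matrix.sub_mul, Matrix.mul_one, Units.inv_mul, Subgroup.coe_mul, Subgroup.coe_mul, Subgroup.coe_inv, Units.val_mul, Units.val_mul]

/-- **THE POWER TOKENS IN A FRAME**: at `v = u·L₀`, `(γ − 1)^k·v ⊆ c·v ↔ |((u⁻¹γu − 1)^k)_{ij}| ≤ |c|` for all `i, j` (★ FILE H `map_toLin'_latt_le_scaleLattice_iff` at the frame `u`,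
`u⁻¹(γ − 1)^k u = (u⁻¹γu − 1)^k`; ★ G3⁺ `forall_v_conj_sub_one_le_iff_map_sub_one_le_scaleLattice` is `k = 1`). [cite: Serre1980Trees, II.1.1] [cite: Kottwitz1986, §3] -/
theorem map_pow_le_scaleLattice_latticeGraphIso_root_iff (hϖ : Valued.v ϖ = WithZero.exp (-1 : ℤ))
    (γ u : unitaryGroupOfForm σ ((StdForm.antidiagonal 3).over K)) {c : K} (hc : c ≠ 0) (k : ℕ) :
    (latticeGraphIso σ ϖ ((StdForm.antidiagonal 3).over K) u ⟨stdLattice K 3, 0, isSelfDualLattice_stdLattice_three_of_v hϖ⟩).1.map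
          ((Matrix.toLin' ((((γ : GL (Fin 3) K) : Matrix (Fin 3) (Fin 3) K) - 1) ^ k)).restrictScalars 𝒪[K]) ≤
        scaleLattice c (latticeGraphIso σ ϖ ((StdForm.antidiagonal 3).over K) u ⟨stdLattice K 3, 0, isSelfDualLattice_stdLattice_three_of_v hϖ⟩).1 ↔
      ∀ i j, Valued.v ((((((u⁻¹ * γ * u : unitaryGroupOfForm σ ((StdForm.antidiagonal 3).over K)) : GL (Fin 3) K) : Matrix (Fin 3) (Fin 3) K) - 1) ^ k) i j) ≤
        Valued.v c := by
  have hrfl : (latticeGraphIso σ ϖ ((StdForm.antidiagonal 3).over K) u ⟨stdLattice K 3, 0, isSelfDualLattice_stdLattice_three_of_v hϖ⟩).1 =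
      latt ((u : GL (Fin 3) K) : Matrix (Fin 3) (Fin 3) K) := rfl
  rw [hrfl, map_toLin'_latt_le_scaleLattice_iff hc _ (Matrix.isUnits_det_units _), ← Matrix.coe_units_inv, ← Units.conj_pow', coe_inv_mul_sub_one_mul_coe_eq]

/-! ## §3 The residual datum from the tokens; junction-ready line counts at `v = u·L₀` -/

/-- **THE RESIDUAL DATUM OF A FIXED VERTEX FROM ITS TOKENS.**  At `v = u·L₀` with `(γ − 1)·v ⊆ ϖ^d·v` (`d` odd) there is an integral `Y₀ = (ϖ^d)⁻¹·(u⁻¹γu − 1)` whose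
residue `Ȳ` is `J̄₀`-SYMMETRIC, and `Ȳ³ = 0 ↔ (γ−1)³·v ⊆ ϖ^{3d+1}·v`, `Ȳ² = 0 ↔ (γ−1)²·v ⊆ ϖ^{2d+1}·v`, `Ȳ = 0 ↔ (γ−1)·v ⊆ ϖ^{d+1}·v` — the hypotheses of ★ G3″∕G3‴∕G3⁗ read
off the junction's `LEV ∕ LEV₂ ∕ LEV₃` tokens. [cite: Kottwitz1986, §3] [cite: Tits1979, §3.5] [cite: BruhatTits1972, §10] -/
theorem exists_residualDatum_of_tokens (hvσ : ∀ z, Valued.v (σ z) = Valued.v z) (hσϖ : σ ϖ = -ϖ) (hϖ : Valued.v ϖ = WithZero.exp (-1 : ℤ))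
    (hres : ∀ x : K, Valued.v x ≤ 1 → Valued.v (σ x - x) < 1)
    (γ u : unitaryGroupOfForm σ ((StdForm.antidiagonal 3).over K)) {d : ℕ} (hd : Odd d)
    (hlev : (latticeGraphIso σ ϖ ((StdForm.antidiagonal 3).over K) u ⟨stdLattice K 3, 0, isSelfDualLattice_stdLattice_three_of_v hϖ⟩).1.map
          ((Matrix.toLin' (((γ : GL (Fin 3) K) : Matrix (Fin 3) (Fin 3) K) - 1)).restrictScalars 𝒪[K]) ≤
        scaleLattice (ϖ ^ d) (latticeGraphIso σ ϖ ((StdForm.antidiagonal 3).over K) u ⟨stdLattice K 3, 0, isSelfDualLattice_stdLattice_three_of_v hϖ⟩).1) :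
    ∃ Y₀ : Matrix (Fin 3) (Fin 3) 𝒪[K],
      (∀ i j, ((Y₀ i j : 𝒪[K]) : K) =
        (ϖ ^ d)⁻¹ * (((((u⁻¹ * γ * u : unitaryGroupOfForm σ ((StdForm.antidiagonal 3).over K)) : GL (Fin 3) K) : Matrix (Fin 3) (Fin 3) K) - 1) i j)) ∧
      ((StdForm.antidiagonal 3).over 𝓀[K])⁻¹ * ((Y₀.map (IsLocalRing.residue 𝒪[K])).map (RingHom.id 𝓀[K]))ᵀ * (StdForm.antidiagonal 3).over 𝓀[K] =
        Y₀.map (IsLocalRing.residue 𝒪[K]) ∧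
      ((Y₀.map (IsLocalRing.residue 𝒪[K])) ^ 3 = 0 ↔
        (latticeGraphIso σ ϖ ((StdForm.antidiagonal 3).over K) u ⟨stdLattice K 3, 0, isSelfDualLattice_stdLattice_three_of_v hϖ⟩).1.map
            ((Matrix.toLin' ((((γ : GL (Fin 3) K) : Matrix (Fin 3) (Fin 3) K) - 1) ^ 3)).restrictScalars 𝒪[K]) ≤
          scaleLattice (ϖ ^ (3 * d + 1)) (latticeGraphIso σ ϖ ((StdForm.antidiagonal 3).over K) u ⟨stdLattice K 3, 0, isSelfDualLattice_stdLattice_three_of_v hϖ⟩).1) ∧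
      (Y₀.map (IsLocalRing.residue 𝒪[K]) * Y₀.map (IsLocalRing.residue 𝒪[K]) = 0 ↔
        (latticeGraphIso σ ϖ ((StdForm.antidiagonal 3).over K) u ⟨stdLattice K 3, 0, isSelfDualLattice_stdLattice_three_of_v hϖ⟩).1.map
            ((Matrix.toLin' ((((γ : GL (Fin 3) K) : Matrix (Fin 3) (Fin 3) K) - 1) ^ 2)).restrictScalars 𝒪[K]) ≤
          scaleLattice (ϖ ^ (2 * d + 1)) (latticeGraphIso σ ϖ ((StdForm.antidiagonal 3).over K) u ⟨stdLattice K 3, 0, isSelfDualLattice_stdLattice_three_of_v hϖ⟩).1) ∧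
      (Y₀.map (IsLocalRing.residue 𝒪[K]) = 0 ↔
        (latticeGraphIso σ ϖ ((StdForm.antidiagonal 3).over K) u ⟨stdLattice K 3, 0, isSelfDualLattice_stdLattice_three_of_v hϖ⟩).1.map
            ((Matrix.toLin' (((γ : GL (Fin 3) K) : Matrix (Fin 3) (Fin 3) K) - 1)).restrictScalars 𝒪[K]) ≤
          scaleLattice (ϖ ^ (d + 1)) (latticeGraphIso σ ϖ ((StdForm.antidiagonal 3).over K) u ⟨stdLattice K 3, 0, isSelfDualLattice_stdLattice_three_of_v hϖ⟩).1) := by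
  have hϖ0 : ϖ ≠ 0 := uniformizer_ne_zero hϖ
  have hpow0 : ∀ n : ℕ, (ϖ ^ n : K) ≠ 0 := fun n => pow_ne_zero _ hϖ0
  -- the entrywise depth-`d` bound in the frame `u`, and the integral leading term
  have hY : ∀ i j, Valued.v (((((u⁻¹ * γ * u : unitaryGroupOfForm σ ((StdForm.antidiagonal 3).over K)) : GL (Fin 3) K) : Matrix (Fin 3) (Fin 3) K) - 1) i j) ≤
      Valued.v ϖ ^ d := by
    have h := (map_pow_le_scaleLattice_latticeGraphIso_root_iff hϖ γ u (hpow0 d) 1).1 (by rw [pow_one]; exact hlev)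
    simpa only [pow_one, map_pow] using h
  obtain ⟨Y₀, hY₀⟩ := (exists_integerMatrix_iff_forall_v_le hϖ _).2 hY
  refine ⟨Y₀, hY₀, antidiagonal_inv_mul_transpose_map_residue_mul_eq_of_odd hvσ hσϖ hϖ hres (u⁻¹ * γ * u) hd hY Y₀ hY₀, ?_, ?_, ?_⟩
  · rw [map_residue_pow_eq_zero_iff hϖ _ Y₀ hY₀ 3, map_pow_le_scaleLattice_latticeGraphIso_root_iff hϖ γ u (hpow0 _) 3, map_pow, mul_comm d 3]
  · rw [← pow_two, map_residue_pow_eq_zero_iff hϖ _ Y₀ hY₀ 2, map_pow_le_scaleLattice_latticeGraphIso_root_iff hϖ γ u (hpow0 _) 2, map_pow, mul_comm d 2]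
  · rw [map_residue_eq_zero_iff hϖ _ Y₀ hY₀, ← pow_one ((((γ : GL (Fin 3) K) : Matrix (Fin 3) (Fin 3) K) - 1)),
      map_pow_le_scaleLattice_latticeGraphIso_root_iff hϖ γ u (hpow0 _) 1, pow_one, map_pow]

/-! ### Junction-ready line counts at `v = u·L₀` (tokens in, numbers out) -/

section Counts

/-- `|2| = 1` ⇒ `2 ≠ 0` in the residue field (as in ★ R2b). [cite: Tits1979, §3.5] -/
private theorem residue_two_ne_zero_G5 (h2 : Valued.v (2 : K) = 1) : (2 : 𝓀[K]) ≠ 0 := by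
  rw [show (2 : 𝓀[K]) = IsLocalRing.residue 𝒪[K] 2 from (map_ofNat _ 2).symm, Ne, residue_eq_zero_iff_v_lt_one]
  exact fun hlt => absurd (show Valued.v (2 : K) < 1 from hlt) (by rw [h2]; exact lt_irrefl 1)

/-- `|2| = 1` ⇒ the residue field has characteristic `≠ 2`. [cite: Tits1979, §3.5] -/
private theorem ringChar_residueField_ne_two_G5 (h2 : Valued.v (2 : K) = 1) : ringChar 𝓀[K] ≠ 2 := by
  intro hc
  apply residue_two_ne_zero_G5 (K := K) h2
  have h := (ringChar.spec 𝓀[K] 2).2 (by rw [hc])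
  exact_mod_cast h

/-- **NULL LINES AT A RANK-TWO VERTEX: `2`.**  At `v = u·L₀` with `(γ−1)·v ⊆ ϖ^d·v`, `d` odd, `¬ (γ−1)²·v ⊆ ϖ^{2d+1}·v` (rank two) and `(γ−1)³·v ⊆ ϖ^{3d+1}·v` (residual nilpotency),
exactly `2` neighbours `(uκ)·N₁` of `v` have a `Q_Ȳ`-null line `κe₀` (★ G3⁗ bridge ∘ ★ G3″ `ν = 2`; the engine's `hR`∕`hO` rows: the inward line and ONE outward null line).
[cite: BruhatTits1972, §10] [cite: Kottwitz1986, §3] -/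
theorem ncard_neighborSet_null_eq_two_of_tokens (hσ : ∀ x, σ (σ x) = x) (hvσ : ∀ a, Valued.v (σ a) = Valued.v a) (hσϖ : σ ϖ = -ϖ)
    (hϖ : Valued.v ϖ = WithZero.exp (-1 : ℤ)) (hres : ∀ x : K, Valued.v x ≤ 1 → Valued.v (σ x - x) < 1) (h2 : Valued.v (2 : K) = 1) [Finite 𝓀[K]]
    (γ u : unitaryGroupOfForm σ ((StdForm.antidiagonal 3).over K)) {d : ℕ} (hd : Odd d)
    (hlev : (latticeGraphIso σ ϖ ((StdForm.antidiagonal 3).over K) u ⟨stdLattice K 3, 0, isSelfDualLattice_stdLattice_three_of_v hϖ⟩).1.map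
          ((Matrix.toLin' (((γ : GL (Fin 3) K) : Matrix (Fin 3) (Fin 3) K) - 1)).restrictScalars 𝒪[K]) ≤
        scaleLattice (ϖ ^ d) (latticeGraphIso σ ϖ ((StdForm.antidiagonal 3).over K) u ⟨stdLattice K 3, 0, isSelfDualLattice_stdLattice_three_of_v hϖ⟩).1)
    (hsq : ¬ (latticeGraphIso σ ϖ ((StdForm.antidiagonal 3).over K) u ⟨stdLattice K 3, 0, isSelfDualLattice_stdLattice_three_of_v hϖ⟩).1.map
          ((Matrix.toLin' ((((γ : GL (Fin 3) K) : Matrix (Fin 3) (Fin 3) K) - 1) ^ 2)).restrictScalars 𝒪[K]) ≤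
        scaleLattice (ϖ ^ (2 * d + 1)) (latticeGraphIso σ ϖ ((StdForm.antidiagonal 3).over K) u ⟨stdLattice K 3, 0, isSelfDualLattice_stdLattice_three_of_v hϖ⟩).1)
    (hcube : (latticeGraphIso σ ϖ ((StdForm.antidiagonal 3).over K) u ⟨stdLattice K 3, 0, isSelfDualLattice_stdLattice_three_of_v hϖ⟩).1.map
          ((Matrix.toLin' ((((γ : GL (Fin 3) K) : Matrix (Fin 3) (Fin 3) K) - 1) ^ 3)).restrictScalars 𝒪[K]) ≤
        scaleLattice (ϖ ^ (3 * d + 1)) (latticeGraphIso σ ϖ ((StdForm.antidiagonal 3).over K) u ⟨stdLattice K 3, 0, isSelfDualLattice_stdLattice_three_of_v hϖ⟩).1) :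
    {c | c ∈ (latticeGraph σ ϖ ((StdForm.antidiagonal 3).over K)).neighborSet
          (latticeGraphIso σ ϖ ((StdForm.antidiagonal 3).over K) u ⟨stdLattice K 3, 0, isSelfDualLattice_stdLattice_three_of_v hϖ⟩) ∧
        ∃ κ : unitaryGroupOfForm σ ((StdForm.antidiagonal 3).over K), κ ∈ unitaryInt σ ((StdForm.antidiagonal 3).over K) ∧
          c.1 = mapGL (((u * κ : unitaryGroupOfForm σ ((StdForm.antidiagonal 3).over K)) : GL (Fin 3) K)) (latt (Matrix.diagonal ![(1 : K), 1, ϖ])) ∧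
          ∃ t : 𝒪[K], (t : K) = (ϖ ^ d)⁻¹ * B₀ σ 3 (((κ : GL (Fin 3) K) : Matrix (Fin 3) (Fin 3) K) *ᵥ (Pi.single 0 1))
              (((((u⁻¹ * γ * u : unitaryGroupOfForm σ ((StdForm.antidiagonal 3).over K)) : GL (Fin 3) K) : Matrix (Fin 3) (Fin 3) K) - 1) *ᵥ
                (((κ : GL (Fin 3) K) : Matrix (Fin 3) (Fin 3) K) *ᵥ (Pi.single 0 1))) ∧ IsLocalRing.residue 𝒪[K] t = 0}.ncard = 2 := by
  obtain ⟨Y₀, hY₀, hYs, h3, h2', -⟩ := exists_residualDatum_of_tokens hvσ hσϖ hϖ hres γ u hd hlev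
  rw [ncard_neighborSet_pred_eq_natCard hσ hvσ hσϖ hϖ hres h2 u _ Y₀ hY₀ (fun t => t = 0)
    (fun c t hc => by rw [mul_eq_zero, mul_eq_zero, or_self, or_iff_right hc])]
  exact natCard_nullParams_eq_two_of_sq_ne_zero (residue_two_ne_zero_G5 h2) hYs (h3.2 hcube) (fun h0 => hsq (h2'.1 h0))

/-- **NULL LINES AT A RANK-ONE VERTEX: `1`.**  At `v = u·L₀` with `(γ−1)·v ⊆ ϖ^d·v`, `d` odd, `(γ−1)²·v ⊆ ϖ^{2d+1}·v` (rank ≤ 1) and `¬ (γ−1)·v ⊆ ϖ^{d+1}·v` (depth exactly `d`),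
exactly `1` neighbour of `v` has a `Q_Ȳ`-null line (★ G3⁗ ∘ ★ G3″ `ν = 1`; the engine's `hC`∕`hP` rows: only the inward line is null). [cite: BruhatTits1972, §10] [cite: Kottwitz1986, §3] -/
theorem ncard_neighborSet_null_eq_one_of_tokens (hσ : ∀ x, σ (σ x) = x) (hvσ : ∀ a, Valued.v (σ a) = Valued.v a) (hσϖ : σ ϖ = -ϖ)
    (hϖ : Valued.v ϖ = WithZero.exp (-1 : ℤ)) (hres : ∀ x : K, Valued.v x ≤ 1 → Valued.v (σ x - x) < 1) (h2 : Valued.v (2 : K) = 1) [Finite 𝓀[K]]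
    (γ u : unitaryGroupOfForm σ ((StdForm.antidiagonal 3).over K)) {d : ℕ} (hd : Odd d)
    (hlev : (latticeGraphIso σ ϖ ((StdForm.antidiagonal 3).over K) u ⟨stdLattice K 3, 0, isSelfDualLattice_stdLattice_three_of_v hϖ⟩).1.map
          ((Matrix.toLin' (((γ : GL (Fin 3) K) : Matrix (Fin 3) (Fin 3) K) - 1)).restrictScalars 𝒪[K]) ≤
        scaleLattice (ϖ ^ d) (latticeGraphIso σ ϖ ((StdForm.antidiagonal 3).over K) u ⟨stdLattice K 3, 0, isSelfDualLattice_stdLattice_three_of_v hϖ⟩).1)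
    (hdepth : ¬ (latticeGraphIso σ ϖ ((StdForm.antidiagonal 3).over K) u ⟨stdLattice K 3, 0, isSelfDualLattice_stdLattice_three_of_v hϖ⟩).1.map
          ((Matrix.toLin' (((γ : GL (Fin 3) K) : Matrix (Fin 3) (Fin 3) K) - 1)).restrictScalars 𝒪[K]) ≤
        scaleLattice (ϖ ^ (d + 1)) (latticeGraphIso σ ϖ ((StdForm.antidiagonal 3).over K) u ⟨stdLattice K 3, 0, isSelfDualLattice_stdLattice_three_of_v hϖ⟩).1)
    (hsq : (latticeGraphIso σ ϖ ((StdForm.antidiagonal 3).over K) u ⟨stdLattice K 3, 0, isSelfDualLattice_stdLattice_three_of_v hϖ⟩).1.map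
          ((Matrix.toLin' ((((γ : GL (Fin 3) K) : Matrix (Fin 3) (Fin 3) K) - 1) ^ 2)).restrictScalars 𝒪[K]) ≤
        scaleLattice (ϖ ^ (2 * d + 1)) (latticeGraphIso σ ϖ ((StdForm.antidiagonal 3).over K) u ⟨stdLattice K 3, 0, isSelfDualLattice_stdLattice_three_of_v hϖ⟩).1) :
    {c | c ∈ (latticeGraph σ ϖ ((StdForm.antidiagonal 3).over K)).neighborSet
          (latticeGraphIso σ ϖ ((StdForm.antidiagonal 3).over K) u ⟨stdLattice K 3, 0, isSelfDualLattice_stdLattice_three_of_v hϖ⟩) ∧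
        ∃ κ : unitaryGroupOfForm σ ((StdForm.antidiagonal 3).over K), κ ∈ unitaryInt σ ((StdForm.antidiagonal 3).over K) ∧
          c.1 = mapGL (((u * κ : unitaryGroupOfForm σ ((StdForm.antidiagonal 3).over K)) : GL (Fin 3) K)) (latt (Matrix.diagonal ![(1 : K), 1, ϖ])) ∧
          ∃ t : 𝒪[K], (t : K) = (ϖ ^ d)⁻¹ * B₀ σ 3 (((κ : GL (Fin 3) K) : Matrix (Fin 3) (Fin 3) K) *ᵥ (Pi.single 0 1))
              (((((u⁻¹ * γ * u : unitaryGroupOfForm σ ((StdForm.antidiagonal 3).over K)) : GL (Fin 3) K) : Matrix (Fin 3) (Fin 3) K) - 1) *ᵥ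
                (((κ : GL (Fin 3) K) : Matrix (Fin 3) (Fin 3) K) *ᵥ (Pi.single 0 1))) ∧ IsLocalRing.residue 𝒪[K] t = 0}.ncard = 1 := by
  obtain ⟨Y₀, hY₀, hYs, -, h2', h1⟩ := exists_residualDatum_of_tokens hvσ hσϖ hϖ hres γ u hd hlev
  rw [ncard_neighborSet_pred_eq_natCard hσ hvσ hσϖ hϖ hres h2 u _ Y₀ hY₀ (fun t => t = 0)
    (fun c t hc => by rw [mul_eq_zero, mul_eq_zero, or_self, or_iff_right hc])]
  exact natCard_nullParams_eq_one_of_sq_eq_zero hYs (h2'.2 hsq) (fun h0 => hdepth (h1.1 h0))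

variable [Fintype 𝓀[K]] [DecidableEq 𝓀[K]]

/-- **THE `hO` LINE COUNT FROM THE TOKENS: `2·#{neighbours of v with line class σ} = q − 1`.**  At `v = u·L₀` with `(γ−1)·v ⊆ ϖ^d·v`, `d` odd, `¬ (γ−1)²·v ⊆ ϖ^{2d+1}·v`,
`(γ−1)³·v ⊆ ϖ^{3d+1}·v`, for `c₀ ≠ 0` and `σ = ±1`: the neighbours `(uκ)·N₁` whose line passes `χ(c₀ · residue((ϖ^d)⁻¹B₀(κe₀, (u⁻¹γu − 1)κe₀))) = σ` number `(q − 1)∕2`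
(★ G3⁗ bridge ∘ ★ G3‴ class split). [cite: BruhatTits1972, §10] [cite: Kottwitz1986, §3] -/
theorem two_mul_ncard_neighborSet_quadraticChar_eq_of_tokens (hσ : ∀ x, σ (σ x) = x) (hvσ : ∀ a, Valued.v (σ a) = Valued.v a) (hσϖ : σ ϖ = -ϖ)
    (hϖ : Valued.v ϖ = WithZero.exp (-1 : ℤ)) (hres : ∀ x : K, Valued.v x ≤ 1 → Valued.v (σ x - x) < 1) (h2 : Valued.v (2 : K) = 1)
    (γ u : unitaryGroupOfForm σ ((StdForm.antidiagonal 3).over K)) {d : ℕ} (hd : Odd d)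
    (hlev : (latticeGraphIso σ ϖ ((StdForm.antidiagonal 3).over K) u ⟨stdLattice K 3, 0, isSelfDualLattice_stdLattice_three_of_v hϖ⟩).1.map
          ((Matrix.toLin' (((γ : GL (Fin 3) K) : Matrix (Fin 3) (Fin 3) K) - 1)).restrictScalars 𝒪[K]) ≤
        scaleLattice (ϖ ^ d) (latticeGraphIso σ ϖ ((StdForm.antidiagonal 3).over K) u ⟨stdLattice K 3, 0, isSelfDualLattice_stdLattice_three_of_v hϖ⟩).1)
    (hsq : ¬ (latticeGraphIso σ ϖ ((StdForm.antidiagonal 3).over K) u ⟨stdLattice K 3, 0, isSelfDualLattice_stdLattice_three_of_v hϖ⟩).1.map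
          ((Matrix.toLin' ((((γ : GL (Fin 3) K) : Matrix (Fin 3) (Fin 3) K) - 1) ^ 2)).restrictScalars 𝒪[K]) ≤
        scaleLattice (ϖ ^ (2 * d + 1)) (latticeGraphIso σ ϖ ((StdForm.antidiagonal 3).over K) u ⟨stdLattice K 3, 0, isSelfDualLattice_stdLattice_three_of_v hϖ⟩).1)
    (hcube : (latticeGraphIso σ ϖ ((StdForm.antidiagonal 3).over K) u ⟨stdLattice K 3, 0, isSelfDualLattice_stdLattice_three_of_v hϖ⟩).1.map
          ((Matrix.toLin' ((((γ : GL (Fin 3) K) : Matrix (Fin 3) (Fin 3) K) - 1) ^ 3)).restrictScalars 𝒪[K]) ≤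
        scaleLattice (ϖ ^ (3 * d + 1)) (latticeGraphIso σ ϖ ((StdForm.antidiagonal 3).over K) u ⟨stdLattice K 3, 0, isSelfDualLattice_stdLattice_three_of_v hϖ⟩).1)
    {c₀ : 𝓀[K]} (hc₀ : c₀ ≠ 0) {s : ℤ} (hs : s = 1 ∨ s = -1) :
    2 * {c | c ∈ (latticeGraph σ ϖ ((StdForm.antidiagonal 3).over K)).neighborSet
          (latticeGraphIso σ ϖ ((StdForm.antidiagonal 3).over K) u ⟨stdLattice K 3, 0, isSelfDualLattice_stdLattice_three_of_v hϖ⟩) ∧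
        ∃ κ : unitaryGroupOfForm σ ((StdForm.antidiagonal 3).over K), κ ∈ unitaryInt σ ((StdForm.antidiagonal 3).over K) ∧
          c.1 = mapGL (((u * κ : unitaryGroupOfForm σ ((StdForm.antidiagonal 3).over K)) : GL (Fin 3) K)) (latt (Matrix.diagonal ![(1 : K), 1, ϖ])) ∧
          ∃ t : 𝒪[K], (t : K) = (ϖ ^ d)⁻¹ * B₀ σ 3 (((κ : GL (Fin 3) K) : Matrix (Fin 3) (Fin 3) K) *ᵥ (Pi.single 0 1))
              (((((u⁻¹ * γ * u : unitaryGroupOfForm σ ((StdForm.antidiagonal 3).over K)) : GL (Fin 3) K) : Matrix (Fin 3) (Fin 3) K) - 1) *ᵥ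
                (((κ : GL (Fin 3) K) : Matrix (Fin 3) (Fin 3) K) *ᵥ (Pi.single 0 1))) ∧
            quadraticChar 𝓀[K] (c₀ * IsLocalRing.residue 𝒪[K] t) = s}.ncard = Nat.card 𝓀[K] - 1 := by
  obtain ⟨Y₀, hY₀, hYs, h3, h2', -⟩ := exists_residualDatum_of_tokens hvσ hσϖ hϖ hres γ u hd hlev
  rw [ncard_neighborSet_pred_eq_natCard hσ hvσ hσϖ hϖ hres h2 u _ Y₀ hY₀ (fun t => quadraticChar 𝓀[K] (c₀ * t) = s)
    (fun c t hc => by rw [show c₀ * (c * c * t) = c ^ 2 * (c₀ * t) by ring, map_mul, quadraticChar_sq_one' hc, one_mul])]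
  exact two_mul_natCard_params_quadraticChar_eq_of_sq_ne_zero (ringChar_residueField_ne_two_G5 h2) hYs (h3.2 hcube) (fun h0 => hsq (h2'.1 h0)) hc₀ hs

/-- **THE `hP` LINE COUNT FROM THE TOKENS (rank one): ONE CLASS CONSTANT `c ≠ 0` FOR ALL LINES** — at `v = u·L₀` with `(γ−1)·v ⊆ ϖ^d·v`, `d` odd, `(γ−1)²·v ⊆ ϖ^{2d+1}·v`,
`¬ (γ−1)·v ⊆ ϖ^{d+1}·v`: there is `c ≠ 0` in `𝓀` (the square class of the vertex, `Ȳ ∼ N(c)` under `O(J̄₀)`) such that for every `c₀` and `σ = ±1` the neighbours whose line has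
`χ(c₀ · residue test) = σ` number `q` if `χ(c₀c) = σ` and `0` otherwise (★ `exists_orthogonal_conj_eq_cornerSymmetric` ∘ ★ G3⁗ ∘ ★ G3‴). [cite: BruhatTits1972, §10]
[cite: Kottwitz1986, §3] -/
theorem exists_ncard_neighborSet_quadraticChar_eq_ite_of_tokens (hσ : ∀ x, σ (σ x) = x) (hvσ : ∀ a, Valued.v (σ a) = Valued.v a) (hσϖ : σ ϖ = -ϖ)
    (hϖ : Valued.v ϖ = WithZero.exp (-1 : ℤ)) (hres : ∀ x : K, Valued.v x ≤ 1 → Valued.v (σ x - x) < 1) (h2 : Valued.v (2 : K) = 1)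
    (γ u : unitaryGroupOfForm σ ((StdForm.antidiagonal 3).over K)) {d : ℕ} (hd : Odd d)
    (hlev : (latticeGraphIso σ ϖ ((StdForm.antidiagonal 3).over K) u ⟨stdLattice K 3, 0, isSelfDualLattice_stdLattice_three_of_v hϖ⟩).1.map
          ((Matrix.toLin' (((γ : GL (Fin 3) K) : Matrix (Fin 3) (Fin 3) K) - 1)).restrictScalars 𝒪[K]) ≤
        scaleLattice (ϖ ^ d) (latticeGraphIso σ ϖ ((StdForm.antidiagonal 3).over K) u ⟨stdLattice K 3, 0, isSelfDualLattice_stdLattice_three_of_v hϖ⟩).1)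
    (hdepth : ¬ (latticeGraphIso σ ϖ ((StdForm.antidiagonal 3).over K) u ⟨stdLattice K 3, 0, isSelfDualLattice_stdLattice_three_of_v hϖ⟩).1.map
          ((Matrix.toLin' (((γ : GL (Fin 3) K) : Matrix (Fin 3) (Fin 3) K) - 1)).restrictScalars 𝒪[K]) ≤
        scaleLattice (ϖ ^ (d + 1)) (latticeGraphIso σ ϖ ((StdForm.antidiagonal 3).over K) u ⟨stdLattice K 3, 0, isSelfDualLattice_stdLattice_three_of_v hϖ⟩).1)
    (hsq : (latticeGraphIso σ ϖ ((StdForm.antidiagonal 3).over K) u ⟨stdLattice K 3, 0, isSelfDualLattice_stdLattice_three_of_v hϖ⟩).1.map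
          ((Matrix.toLin' ((((γ : GL (Fin 3) K) : Matrix (Fin 3) (Fin 3) K) - 1) ^ 2)).restrictScalars 𝒪[K]) ≤
        scaleLattice (ϖ ^ (2 * d + 1)) (latticeGraphIso σ ϖ ((StdForm.antidiagonal 3).over K) u ⟨stdLattice K 3, 0, isSelfDualLattice_stdLattice_three_of_v hϖ⟩).1) :
    ∃ c : 𝓀[K], c ≠ 0 ∧ ∀ (c₀ : 𝓀[K]) (s : ℤ), (s = 1 ∨ s = -1) →
      {w | w ∈ (latticeGraph σ ϖ ((StdForm.antidiagonal 3).over K)).neighborSet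
            (latticeGraphIso σ ϖ ((StdForm.antidiagonal 3).over K) u ⟨stdLattice K 3, 0, isSelfDualLattice_stdLattice_three_of_v hϖ⟩) ∧
          ∃ κ : unitaryGroupOfForm σ ((StdForm.antidiagonal 3).over K), κ ∈ unitaryInt σ ((StdForm.antidiagonal 3).over K) ∧
            w.1 = mapGL (((u * κ : unitaryGroupOfForm σ ((StdForm.antidiagonal 3).over K)) : GL (Fin 3) K)) (latt (Matrix.diagonal ![(1 : K), 1, ϖ])) ∧
            ∃ t : 𝒪[K], (t : K) = (ϖ ^ d)⁻¹ * B₀ σ 3 (((κ : GL (Fin 3) K) : Matrix (Fin 3) (Fin 3) K) *ᵥ (Pi.single 0 1))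
                (((((u⁻¹ * γ * u : unitaryGroupOfForm σ ((StdForm.antidiagonal 3).over K)) : GL (Fin 3) K) : Matrix (Fin 3) (Fin 3) K) - 1) *ᵥ
                  (((κ : GL (Fin 3) K) : Matrix (Fin 3) (Fin 3) K) *ᵥ (Pi.single 0 1))) ∧
              quadraticChar 𝓀[K] (c₀ * IsLocalRing.residue 𝒪[K] t) = s}.ncard =
        if quadraticChar 𝓀[K] (c₀ * c) = s then Nat.card 𝓀[K] else 0 := by
  obtain ⟨Y₀, hY₀, hYs, -, h2', h1⟩ := exists_residualDatum_of_tokens hvσ hσϖ hϖ hres γ u hd hlev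
  obtain ⟨c, hc, g, hg, hY⟩ := exists_orthogonal_conj_eq_cornerSymmetric hYs (h2'.2 hsq) (fun h0 => hdepth (h1.1 h0))
  refine ⟨c, hc, fun c₀ s hs => ?_⟩
  rw [ncard_neighborSet_pred_eq_natCard hσ hvσ hσϖ hϖ hres h2 u _ Y₀ hY₀ (fun t => quadraticChar 𝓀[K] (c₀ * t) = s)
    (fun c t hc => by rw [show c₀ * (c * c * t) = c ^ 2 * (c₀ * t) by ring, map_mul, quadraticChar_sq_one' hc, one_mul])]
  exact natCard_params_quadraticChar_eq_ite_of_conj_cornerSymmetric (ringChar_residueField_ne_two_G5 h2) hg hY c₀ hs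

end Counts

end Literature.NumberTheory.Automorphic.UnitaryLatticeTree

end
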